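import Summits.ValiantsHypothesis.ValiantsHypothesis.Theorems.KPlusLogSqLawTropicalBRegisterPairGadget

/-!
# Route «KPlusLogSqLaw», crux `TropicalB` (stmt-ValiantsHypothesis-19771) — THE THETA-GAP LAW
# (quantitative parallelogram law: the slope gap between the two inner optima of an arithmetic quadruple is bounded by the value margin)

HONEST FRAMING.  Helper toward the registered stubs `stub_tropThin` / `stub_tropFat` of `Cruxes/TropicalB/Lines/birth.lean` (crux
`Summit.ValiantsHypothesis.ValiantsHypothesis.Theses.KPlusLogSqLaw.TropicalB`, item stmt-ValiantsHypothesis-19771, route KPlusLogSqLaw;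
cell `pub-symmetroid`, seat val-sym-trop-p4 g11, 2026-08-27; `--supports … --as helper`).  A STRUCTURE lemma about unique optima of an
ARBITRARY dominance design, the quantitative form of `RegisterPair.parallelogram` (…TropicalBRegisterPairGadget); nothing here bounds
`TropicalB`, and nothing bears on `WeakLifting`, DoorA26 / DoorA34, `MatrixDescartes` (stmt-ValiantsHypothesis-18050) or VP ≠ VNP.

THE LAW (`theta_gap`).  Four terms with slopes `S_A + S_D = S_B + S_C`, `S_A < S_B`, `S_A < S_C`; `B` the unique optimum at `θB`, `C` at `θC`,
`A`, `D` present; `M = (V_A + V_D) − (V_B + V_C)` the value margin (positive by `parallelogram`).  Then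
`(θC − θB)·(S_B − S_A) < M` and `(θB − θC)·(S_C − S_A) < M`: whichever of the two inner optima comes later, the product of the slope
gap with the corresponding side of the parallelogram is below the margin.  This is the θ-information the parallelogram law throws away; it
is the quantitative input of the seat's located THREE-ANTICHAIN LAW (memo REGISTER-PAIR-g11.md §5: for two dominant same-side states of an
antichain the margin is the supermodularity defect of the gadget values, half an internal path of the gadget's tree metric).
[folklore: lower convex hulls; the packaging is the cell's]
-/

set_option linter.dupNamespace false
set_option autoImplicit false

namespace Summit.ValiantsHypothesis.ValiantsHypothesis.Theorems.KPlusLogSqLaw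

namespace RegisterPair

open Summit.ValiantsHypothesis.ValiantsHypothesis.Theorems.MatrixDescartes.Negative
open Summit.ValiantsHypothesis.ValiantsHypothesis.Theorems.LacunarySymmetroidMatrixDescartes.TropicalCensus
open scoped BigOperators
open Finset

variable {m K : ℕ}

/-- **THETA-GAP LAW.**  See the module docstring. [folklore] -/
theorem theta_gap (d : Fin K → ℕ) (v ε : Fin m → Fin m → Fin K → ℤ) {θB θC : ℤ}
    {A B C D : Equiv.Perm (Fin m) × (Fin m → Fin K)}
    (hB : IsDominant d v ε θB B) (hC : IsDominant d v ε θC C) (hA : termSign ε A ≠ 0) (hD : termSign ε D ≠ 0)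
    (hS : slope d A + slope d D = slope d B + slope d C) (hAB : slope d A < slope d B) (hAC : slope d A < slope d C) :
    (θC - θB) * (slope d B - slope d A) <
        ((∑ i, v (A.1 i) i (A.2 i)) + ∑ i, v (D.1 i) i (D.2 i)) - ((∑ i, v (B.1 i) i (B.2 i)) + ∑ i, v (C.1 i) i (C.2 i)) ∧
      (θB - θC) * (slope d C - slope d A) <
        ((∑ i, v (A.1 i) i (A.2 i)) + ∑ i, v (D.1 i) i (D.2 i)) - ((∑ i, v (B.1 i) i (B.2 i)) + ∑ i, v (C.1 i) i (C.2 i)) := by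
  have hBD : slope d B < slope d D := by linarith
  have hCD : slope d C < slope d D := by linarith
  have hAneB : A ≠ B := fun h => by rw [h] at hAB; exact lt_irrefl _ hAB
  have hAneC : A ≠ C := fun h => by rw [h] at hAC; exact lt_irrefl _ hAC
  have hDneB : D ≠ B := fun h => by rw [h] at hBD; exact lt_irrefl _ hBD
  have hDneC : D ≠ C := fun h => by rw [h] at hCD; exact lt_irrefl _ hCD
  have h1 := hB.2 A hAneB hA
  have h2 := hB.2 D hDneB hD
  have h3 := hC.2 A hAneC hA
  have h4 := hC.2 D hDneC hD
  rw [tropWeight_eq_slope_sub, tropWeight_eq_slope_sub] at h1 h2 h3 h4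
  set sA := slope d A
  set sB := slope d B
  set sC := slope d C
  set sD := slope d D
  set VA := ∑ i, v (A.1 i) i (A.2 i)
  set VB := ∑ i, v (B.1 i) i (B.2 i)
  set VC := ∑ i, v (C.1 i) i (C.2 i)
  set VD := ∑ i, v (D.1 i) i (D.2 i)
  have hD' : sD = sB + sC - sA := by linarith
  rw [hD'] at h2 h4
  constructor
  · nlinarith [h1, h4]
  · nlinarith [h2, h3]

/-- **Corollary: the two θ's are close when both sides are long.**  With the margin `M` as above, `|θB − θC| · min(S_B − S_A, S_C − S_A) < M`
in the one-sided forms of `theta_gap`; in particular if `S_B − S_A = S_C − S_A` then `|θB − θC| · (S_B − S_A) < M`. [folklore] -/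
theorem theta_gap_abs (d : Fin K → ℕ) (v ε : Fin m → Fin m → Fin K → ℤ) {θB θC : ℤ}
    {A B C D : Equiv.Perm (Fin m) × (Fin m → Fin K)}
    (hB : IsDominant d v ε θB B) (hC : IsDominant d v ε θC C) (hA : termSign ε A ≠ 0) (hD : termSign ε D ≠ 0)
    (hS : slope d A + slope d D = slope d B + slope d C) (hAB : slope d A < slope d B) (hBC : slope d B = slope d C) :
    |θB - θC| * (slope d B - slope d A) <
        ((∑ i, v (A.1 i) i (A.2 i)) + ∑ i, v (D.1 i) i (D.2 i)) - ((∑ i, v (B.1 i) i (B.2 i)) + ∑ i, v (C.1 i) i (C.2 i)) := by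
  obtain ⟨h1, h2⟩ := theta_gap d v ε hB hC hA hD hS hAB (hBC ▸ hAB)
  rw [← hBC] at h2
  rcases le_or_gt θC θB with h | h
  · rw [abs_of_nonneg (by linarith)]; exact h2
  · rw [abs_of_neg (by linarith)]; linarith

end RegisterPair

end Summit.ValiantsHypothesis.ValiantsHypothesis.Theorems.KPlusLogSqLaw
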